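import Literature.AlgebraicGeometry.HodgeTheory.DiagonalCharacterEigenspace
import Literature.AlgebraicGeometry.Motives.Sweep1
import Mathlib.RingTheory.RootsOfUnity.Complex
import HarnessLib

/-!
# The group `μₘⁿ⁺²` of diagonal symmetries of the Fermat variety and its character eigenspaces

Family `hodge`, layer `Literature/AlgebraicGeometry/HodgeTheory`. Brick of the middle-degree case of
the named fact `hodgeClasses_algebraic_fermat` (file `FermatHodgeConjecture`): the geometric half of
Shioda, Proc. Japan Acad. 55A (1979) §4 / Math. Ann. 245 (1979) §1 ("let `G = Gⁿₘ` be the quotient of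
`μₘⁿ⁺²` by the diagonal; `G` acts on `Xⁿₘ` by `(x_i) ↦ (ζ_i x_i)` and `Hⁿ_prim(Xⁿₘ, ℂ) = ⊕_α V(α)`,
`α` running over the characters of `G`"), Ran, Compositio Math. 42 (1980) §1 Prop. 1.7, on the
tree's carriers: the Fermat hypersurface is `X_F = Motives.SmoothHypersurface.hypersurface F` for the
Fermat form `F = Motives.fermatPolynomial ℂ n m = Σ xᵢᵐ`, its complex Betti cohomology is
`complexBetti X_F k = Hᵏ(X_F(ℂ); ℂ)`, the diagonal symmetries and their character eigenspaces are
those of `DiagonalSymmetry` / `DiagonalCharacterEigenspace` (Katz 2009 §3). Everything is PROVED: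

* `fermatGroup n m = μₘⁿ⁺² ≤ (ℂˣ)ⁿ⁺²` and `fermatGroup_le_diagonalStabilizer`: it fixes the Fermat
  form, so every `a ∈ μₘⁿ⁺²` acts on `X_F` by the algebraic automorphism `[x] ↦ [a • x]`
  (`diagonalAut`, `diagonalMap` of `DiagonalSymmetry`); `fermatGroupEquiv : μₘⁿ⁺² ≃* fermatGroup`,
  finiteness and `card_fermatGroup = m ^ (n + 2)`;
* `fermatCharacter m α : fermatGroup n m →* ℂˣ`, `a ↦ ∏ aᵢ^{⟨αᵢ⟩}` for `α ∈ (ℤ/m)ⁿ⁺²`, and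
  `fermatCharacterEquiv : (ℤ/m)ⁿ⁺² ≃ (fermatGroup n m →* ℂˣ)` (injective by evaluating at a primitive
  root in one slot; bijective by counting, `|Ĝ| = |G| = mⁿ⁺²`);
* `fermatEigenspace m α k = V(α) ⊆ Hᵏ(X_F(ℂ); ℂ)` (the `χ_α`-eigenspace) and the **character
  decomposition `Hᵏ(X_F(ℂ); ℂ) = ⊕_{α ∈ (ℤ/m)ⁿ⁺²} V(α)`** (`isInternal_fermatEigenspace`, from
  `isInternal_diagonalCharacterEigenspace`);
* `fermatEigenspace_eq_bot_of_sum_ne_zero`: **`V(α) = 0` unless `Σ αᵢ = 0`** — the diagonal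
  `Δ = {(ζ, …, ζ)}` acts trivially on `ℙⁿ⁺¹`, so only characters of `μₘⁿ⁺²/Δ` occur (Shioda's
  condition `Σ aᵢ ≡ 0 (mod m)` in the definition of `𝔄ⁿₘ`; Ran's `Σ χⱼ = 0`).

NOT here (the remaining, deep, input of the middle-degree case): `dim V(α) = 1` for `α ∈ 𝔄ⁿₘ` and
`V(α) ∩ Hⁿ = 0` for `α ∉ 𝔄ⁿₘ ∪ {0}` with the Hodge type `V(α) ⊂ H^{|α|-1, n+1-|α|}` (Ran Prop. 1.7,
Griffiths residues / Pham), and the classes of linear subspaces.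

## References

* [Shioda1979PJA] T. Shioda, The Hodge conjecture and the Tate conjecture for Fermat varieties,
  Proc. Japan Acad. 55A (1979) 111–114, §4 (the group `Gⁿₘ`, the eigenspaces `V(α)`) (text read).
* [Ran1980] Z. Ran, Cycles on Fermat hypersurfaces, Compositio Math. 42 (1980) 121–142, §1,
  Prop. 1.7 (character decomposition of `Pₙ(Vⁿₘ)` under `Γₘⁿ = μₘⁿ⁺²/Δ`) (text read, numdam).
* [Katz2009] N. M. Katz, Another look at the Dwork family, Progr. Math. 270 (2009), §3 (the action
  of `Γ_W`, "the diagonal subgroup `Δ` acts trivially", eigendecomposition).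
-/

noncomputable section

open CategoryTheory AlgebraicGeometry MvPolynomial

namespace Literature.AlgebraicGeometry.HodgeTheory

open Literature.AlgebraicGeometry.Motives Literature.AlgebraicTopology.SingularHomology

variable {n : ℕ} (m : ℕ)

/-! ### The group `μₘⁿ⁺²` and its action on the Fermat hypersurface -/

/-- The group `μₘⁿ⁺² ≤ (ℂˣ)ⁿ⁺²` of diagonal symmetries `xᵢ ↦ ζᵢ xᵢ`, `ζᵢᵐ = 1`, of the Fermat form
`Σ xᵢᵐ` (Shioda's `μₘⁿ⁺²`, whose quotient by the diagonal is `Gⁿₘ`). [cite: Shioda1979PJA, §4] -/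
def fermatGroup (n m : ℕ) : Subgroup (Fin (n + 2) → ℂˣ) :=
  Subgroup.pi Set.univ fun _ ↦ rootsOfUnity m ℂ

variable {m}

/-- `a ∈ μₘⁿ⁺² ↔ aᵢᵐ = 1` for all `i`. [cite: Shioda1979PJA, §4] -/
theorem mem_fermatGroup_iff {a : Fin (n + 2) → ℂˣ} : a ∈ fermatGroup n m ↔ ∀ i, a i ^ m = 1 := by
  simp [fermatGroup, Subgroup.mem_pi, mem_rootsOfUnity]

variable (m) in
/-- **`μₘⁿ⁺²` fixes the Fermat form**: `Σ (aᵢ xᵢ)ᵐ = Σ xᵢᵐ`, so `μₘⁿ⁺² ≤ diagonalStabilizer F` and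
every `a ∈ μₘⁿ⁺²` acts on `Xⁿₘ` by `[x] ↦ [a • x]` (`diagonalAut`, `diagonalMap`).
[cite: Shioda1979PJA, §4] [cite: Katz2009, §3] -/
theorem fermatGroup_le_diagonalStabilizer :
    fermatGroup n m ≤ diagonalStabilizer (fermatPolynomial ℂ n m) := by
  intro a ha
  rw [mem_diagonalStabilizer_iff, fermatPolynomial, map_sum]
  refine Finset.sum_congr rfl fun i _ ↦ ?_
  have hi : ((a i : ℂˣ) : ℂ) ^ m = 1 := by
    rw [← Units.val_pow_eq_pow_val, mem_fermatGroup_iff.mp ha i, Units.val_one]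
  rw [map_pow, aeval_X, diagonalSubst_apply, mul_pow, ← map_pow, hi, map_one, one_mul]

variable (m) in
/-- `μₘⁿ⁺²` as the product of `n + 2` copies of `μₘ ≤ ℂˣ`. [folklore] -/
def fermatGroupEquiv : (Fin (n + 2) → rootsOfUnity m ℂ) ≃* fermatGroup n m where
  toFun ζ := ⟨fun i ↦ (ζ i : ℂˣ), mem_fermatGroup_iff.mpr fun i ↦ (mem_rootsOfUnity _ _).mp (ζ i).2⟩
  invFun a := fun i ↦ ⟨(a : Fin (n + 2) → ℂˣ) i, (mem_rootsOfUnity _ _).mpr (mem_fermatGroup_iff.mp a.2 i)⟩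
  left_inv ζ := by ext i; rfl
  right_inv a := by ext i; rfl
  map_mul' ζ η := by ext i; rfl

/-- Coordinates of `fermatGroupEquiv`. [folklore] -/
@[simp]
theorem fermatGroupEquiv_apply_coe (ζ : Fin (n + 2) → rootsOfUnity m ℂ) (i : Fin (n + 2)) :
    ((fermatGroupEquiv m ζ : fermatGroup n m) : Fin (n + 2) → ℂˣ) i = (ζ i : ℂˣ) := rfl

/-- `μₘⁿ⁺²` is finite (`m ≥ 1`). [folklore] -/
instance instFiniteFermatGroup [NeZero m] : Finite (fermatGroup n m) :=
  Finite.of_equiv _ (fermatGroupEquiv m).toEquiv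

/-- (noncomputable `Fintype` structure on `μₘⁿ⁺²`, for the sums `Σ_{a ∈ G}` of the isotypic
projectors). [folklore] -/
instance instFintypeFermatGroup [NeZero m] : Fintype (fermatGroup n m) :=
  Fintype.ofFinite _

variable (n m) in
/-- `|μₘⁿ⁺²| = mⁿ⁺²` (`m ≥ 1`). [cite: Shioda1979PJA, §4] -/
theorem card_fermatGroup [NeZero m] : Nat.card (fermatGroup n m) = m ^ (n + 2) := by
  rw [← Nat.card_congr (fermatGroupEquiv m).toEquiv, Nat.card_pi, Finset.prod_const,
    Finset.card_univ, Fintype.card_fin, Complex.card_rootsOfUnity]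

/-- The characters of the finite commutative group `μₘⁿ⁺²` form a finite set (`|Ĝ| = |G|`).
[folklore] -/
instance instFiniteMonoidHomFermatGroup [NeZero m] : Finite (fermatGroup n m →* ℂˣ) :=
  Nat.finite_of_card_ne_zero (by
    rw [CommGroup.card_monoidHom_of_hasEnoughRootsOfUnity (fermatGroup n m) ℂ, card_fermatGroup]
    exact pow_ne_zero _ (NeZero.ne m))

/-- (noncomputable `Fintype` on the characters, for the sums `Σ_χ`). [folklore] -/
instance instFintypeMonoidHomFermatGroup [NeZero m] : Fintype (fermatGroup n m →* ℂˣ) :=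
  Fintype.ofFinite _

/-! ### The characters `χ_α`, `α ∈ (ℤ/m)ⁿ⁺²` -/

variable (m) in
/-- **The character `χ_α : μₘⁿ⁺² → ℂˣ`, `a ↦ ∏ᵢ aᵢ^{⟨αᵢ⟩}`** attached to `α = (α₀, …, α_{n+1}) ∈ (ℤ/m)ⁿ⁺²`
(`⟨αᵢ⟩ ∈ [0, m-1]` the representative). [cite: Shioda1979PJA, §4] [cite: Ran1980, §1 Prop. 1.7] -/
def fermatCharacter (α : Fin (n + 2) → ZMod m) : fermatGroup n m →* ℂˣ where
  toFun a := ∏ i, (a : Fin (n + 2) → ℂˣ) i ^ (α i).val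
  map_one' := by simp
  map_mul' a b := by
    simp only [Subgroup.coe_mul, Pi.mul_apply, mul_pow, Finset.prod_mul_distrib]

/-- `χ_α(a) = ∏ aᵢ^{⟨αᵢ⟩}`. [folklore] -/
theorem fermatCharacter_apply (α : Fin (n + 2) → ZMod m) (a : fermatGroup n m) :
    fermatCharacter m α a = ∏ i, (a : Fin (n + 2) → ℂˣ) i ^ (α i).val := rfl

/-- The element `(1, …, ζ, …, 1)` of `μₘⁿ⁺²` (`ζ ∈ μₘ` in slot `i`). [folklore] -/
def fermatGroupSingle (i : Fin (n + 2)) (ζ : rootsOfUnity m ℂ) : fermatGroup n m :=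
  fermatGroupEquiv m (Pi.mulSingle i ζ)

/-- `χ_α(1, …, ζ, …, 1) = ζ^{⟨αᵢ⟩}`. [folklore] -/
theorem fermatCharacter_fermatGroupSingle (α : Fin (n + 2) → ZMod m) (i : Fin (n + 2))
    (ζ : rootsOfUnity m ℂ) : fermatCharacter m α (fermatGroupSingle i ζ) = (ζ : ℂˣ) ^ (α i).val := by
  classical
  rw [fermatCharacter_apply, Finset.prod_eq_single i]
  · simp [fermatGroupSingle]
  · intro j _ hj
    simp [fermatGroupSingle, Pi.mulSingle_eq_of_ne hj]
  · simp

/-- The diagonal element `(ζ, …, ζ)` of `μₘⁿ⁺²`. [cite: Katz2009, §3] -/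
theorem const_mem_fermatGroup {u : ℂˣ} (hu : u ^ m = 1) : (fun _ ↦ u : Fin (n + 2) → ℂˣ) ∈ fermatGroup n m :=
  mem_fermatGroup_iff.mpr fun _ ↦ hu

/-- `χ_α(ζ, …, ζ) = ζ^{Σ ⟨αᵢ⟩}`. [folklore] -/
theorem fermatCharacter_const (α : Fin (n + 2) → ZMod m) {u : ℂˣ} (hu : u ^ m = 1) :
    fermatCharacter m α ⟨_, const_mem_fermatGroup hu⟩ = u ^ ∑ i, (α i).val := by
  rw [fermatCharacter_apply, Finset.prod_pow_eq_pow_sum]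

/-- **`α ↦ χ_α` is injective**: evaluate at `(1, …, ζ, …, 1)` with `ζ` a primitive `m`-th root of
unity. [cite: Shioda1979PJA, §4] -/
theorem fermatCharacter_injective [NeZero m] : Function.Injective (fermatCharacter (n := n) m) := by
  intro α β h
  funext i
  have hζ := Complex.isPrimitiveRoot_exp m (NeZero.ne m)
  set ζ : rootsOfUnity m ℂ := hζ.toRootsOfUnity with hζdef
  have hζ' : IsPrimitiveRoot ((ζ : ℂˣ) : ℂ) m := by simpa [hζdef] using hζ
  have hζu : IsPrimitiveRoot (ζ : ℂˣ) m := IsPrimitiveRoot.coe_units_iff.mp hζ'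
  have := congrArg (fun χ ↦ χ (fermatGroupSingle i ζ)) h
  simp only [fermatCharacter_fermatGroupSingle] at this
  exact ZMod.val_injective m (hζu.pow_inj (ZMod.val_lt _) (ZMod.val_lt _) this)

/-- **`α ↦ χ_α` is a bijection `(ℤ/m)ⁿ⁺² ≃ Hom(μₘⁿ⁺², ℂˣ)`** (injective, and both sides have
`mⁿ⁺²` elements: `|Ĝ| = |G|`). [cite: Shioda1979PJA, §4] [cite: Ran1980, §1 Prop. 1.7] -/
theorem fermatCharacter_bijective [NeZero m] : Function.Bijective (fermatCharacter (n := n) m) := by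
  classical
  refine (Fintype.bijective_iff_injective_and_card _).mpr ⟨fermatCharacter_injective, ?_⟩
  rw [Fintype.card_pi, Finset.prod_const, Finset.card_univ, Fintype.card_fin, ZMod.card,
    ← Nat.card_eq_fintype_card (α := fermatGroup n m →* ℂˣ),
    CommGroup.card_monoidHom_of_hasEnoughRootsOfUnity (fermatGroup n m) ℂ, card_fermatGroup]

/-- The bijection `α ↦ χ_α` as an equivalence. [cite: Shioda1979PJA, §4] -/
def fermatCharacterEquiv [NeZero m] : (Fin (n + 2) → ZMod m) ≃ (fermatGroup n m →* ℂˣ) :=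
  Equiv.ofBijective _ fermatCharacter_bijective

/-- `fermatCharacterEquiv α = χ_α`. [folklore] -/
@[simp]
theorem fermatCharacterEquiv_apply [NeZero m] (α : Fin (n + 2) → ZMod m) :
    fermatCharacterEquiv α = fermatCharacter m α := rfl

/-! ### The eigenspaces `V(α)` and the character decomposition of `Hᵏ(Xⁿₘ(ℂ); ℂ)` -/

variable (m) in
/-- **The eigenspace `V(α) ⊆ Hᵏ(Xⁿₘ(ℂ); ℂ)`** of the character `χ_α` of `μₘⁿ⁺²` acting by pull-back
along the automorphisms `[x] ↦ [a • x]` of the Fermat hypersurface `X_F`, `F = Σ xᵢᵐ` (Shioda's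
`V(α) = {ξ | g^*ξ = α(g) ξ}`; the tree's `diagonalCharacterEigenspace`).
[cite: Shioda1979PJA, §4] [cite: Ran1980, §1 Prop. 1.7] -/
abbrev fermatEigenspace (α : Fin (n + 2) → ZMod m) (k : ℕ) :
    Submodule ℂ (complexBetti (SmoothHypersurface.hypersurface (fermatPolynomial ℂ n m)) k) :=
  diagonalCharacterEigenspace (fermatPolynomial ℂ n m) (fermatGroup n m) (fermatCharacter m α) k

/-- Membership in `V(α)`: `g_a^* c = χ_α(a) • c` for all `a ∈ μₘⁿ⁺²`. [cite: Shioda1979PJA, §4] -/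
theorem mem_fermatEigenspace_iff {α : Fin (n + 2) → ZMod m} {k : ℕ}
    {c : complexBetti (SmoothHypersurface.hypersurface (fermatPolynomial ℂ n m)) k} :
    c ∈ fermatEigenspace m α k ↔ ∀ a : fermatGroup n m,
      singularCohomology.map ℂ ℂ (diagonalMap (fermatPolynomial ℂ n m) (fermatGroup_le_diagonalStabilizer m a.2)) k c =
        ((fermatCharacter m α a : ℂˣ) : ℂ) • c :=
  mem_diagonalCharacterEigenspace_iff_diagonalMap (fermatGroup_le_diagonalStabilizer m)

/-- **Character decomposition `Hᵏ(Xⁿₘ(ℂ); ℂ) = ⊕_{α ∈ (ℤ/m)ⁿ⁺²} V(α)`** (`m ≥ 1`): the tree's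
`isInternal_diagonalCharacterEigenspace` for the finite group `μₘⁿ⁺² ≤ diagonalStabilizer F`,
re-indexed by `α ↦ χ_α`. [cite: Shioda1979PJA, §4] [cite: Ran1980, §1 Prop. 1.7 (i)] -/
theorem isInternal_fermatEigenspace [NeZero m] (k : ℕ) :
    DirectSum.IsInternal fun α : Fin (n + 2) → ZMod m ↦ fermatEigenspace m α k := by
  classical
  have h := isInternal_diagonalCharacterEigenspace (fermatPolynomial ℂ n m) (k := k)
    (fermatGroup_le_diagonalStabilizer m)
  rw [DirectSum.isInternal_submodule_iff_iSupIndep_and_iSup_eq_top] at h ⊢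
  refine ⟨?_, ?_⟩
  · exact h.1.comp fermatCharacter_injective
  · rw [← h.2]
    exact (fermatCharacter_bijective.surjective.iSup_comp
      fun χ ↦ diagonalCharacterEigenspace (fermatPolynomial ℂ n m) (fermatGroup n m) χ k)

/-- Every class is the sum of its `V(α)`-components: `⨆_α V(α) = ⊤`. [cite: Shioda1979PJA, §4] -/
theorem iSup_fermatEigenspace_eq_top [NeZero m] (k : ℕ) :
    ⨆ α : Fin (n + 2) → ZMod m, fermatEigenspace m α k = ⊤ := by
  classical
  exact ((DirectSum.isInternal_submodule_iff_iSupIndep_and_iSup_eq_top _).mp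
    (isInternal_fermatEigenspace k)).2

/-- The `V(α)` are independent. [cite: Shioda1979PJA, §4] -/
theorem iSupIndep_fermatEigenspace [NeZero m] (k : ℕ) :
    iSupIndep fun α : Fin (n + 2) → ZMod m ↦ fermatEigenspace m α k := by
  classical
  exact ((DirectSum.isInternal_submodule_iff_iSupIndep_and_iSup_eq_top _).mp
    (isInternal_fermatEigenspace k)).1

/-- **`V(α) = 0` unless `Σ αᵢ = 0` in `ℤ/m`**: the diagonal element `(ζ, …, ζ)`, `ζ = e^{2πi/m}`,
acts trivially on `ℙⁿ⁺¹` hence on `Hᵏ(Xⁿₘ(ℂ); ℂ)`, while `χ_α(ζ, …, ζ) = ζ^{Σ⟨αᵢ⟩} ≠ 1`. So only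
the characters of `Gⁿₘ = μₘⁿ⁺²/Δ` (Shioda's `Σ aᵢ ≡ 0`) have non-zero eigenspaces.
[cite: Shioda1979PJA, §1 eq. (3) and §4] [cite: Katz2009, §3] -/
theorem fermatEigenspace_eq_bot_of_sum_ne_zero [NeZero m] {α : Fin (n + 2) → ZMod m}
    (hα : ∑ i, α i ≠ 0) (k : ℕ) : fermatEigenspace m α k = ⊥ := by
  have hζ := Complex.isPrimitiveRoot_exp m (NeZero.ne m)
  have hζu : IsPrimitiveRoot (hζ.isUnit NeZero.out).unit m := IsPrimitiveRoot.coe_units_iff.mp (by simpa using hζ)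
  have hu : (hζ.isUnit NeZero.out).unit ^ m = 1 := hζu.pow_eq_one
  refine diagonalCharacterEigenspace_eq_bot_of_const (fermatGroup_le_diagonalStabilizer m)
    (const_mem_fermatGroup hu) ?_
  rw [fermatCharacter_const α hu]
  intro h1
  have hdvd : m ∣ ∑ i, (α i).val := (hζu.pow_eq_one_iff_dvd _).mp h1
  apply hα
  have : ((∑ i, (α i).val : ℕ) : ZMod m) = 0 := (ZMod.natCast_eq_zero_iff _ _).mpr hdvd
  simpa [ZMod.natCast_zmod_val] using this

end Literature.AlgebraicGeometry.HodgeTheory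

end
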